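import Summits.HubbardSuperconductivity.HubbardSuperconductivity.Theorems.AnisotropyChordTransferFibre3N1RowExprJ

/-!
# Route `AnisotropyChord` / H0 rotor rung, LEVEL 2 row `N₁`: the `RExpr` transcription, part 5 — staged cell box, assembly of
`c₁″`, and the cell checker `n1CellCheck`

Blueprint: HOME/hubbard-h0-rotor-p2/level2_N1_hat_hybrid.py (`assemble_hat`) and the design memo LEVEL2-EVAL-DESIGN-g4.md §3–§5.
(1) STAGED BOX.  Starting from the sixteen-variable cell box `L2.NamedCell.box c a₁ a₂` of `…Fibre3L2Vars` (`t = θ² ∈ [0, θ₀²]`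
for all `L ≥ 128`, `π²`, the `ν`-cell, the `a`-cell, twelve named-sum brackets), `extendBox` appends one coordinate per
`(lo, hi) : RExpr × RExpr` spec, boxed by the enclosures of `lo`/`hi` on the box built so far (the generic two-stage step whose
soundness is `L2.unknown_mem_of_encl` + `L2.mem_append_single`): `ê₁ ∈ [½ − t/24, ½]`, `x₁₇ = ε*(ε̂_M)` (see `emSpec`: makes `κ` the repaired slope `κ̂′`),
`cos(θ/2) ∈ [1 − t/8, 1]`, the block propagators `ĝ(q) ∈ [ghatLoE, ghatHiE]` (`L2.ghat_bounds`), the block tails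
`t̂(q) ∈ [−2ac_sĝ(q)ε, min(σ̂, 2c_su/(Ê(q)/2 − 2ν))]` (`TtailBounds`), `cos(mθ) ∈ [1 − m²t/2, 1 − m²t/2 + m⁴t²/24]`,
`w_n ∈ [n²/2 − n⁴t/24, n²/2]` — in the index order of parts 1–4 (`specs M₂`).
(2) OBJECT STAGE.  The five objects `B̂, P̂, Â, Q̂₁, Ĵ₁` are enclosed once each (`objSpecs M₂` = the brackets of parts 1–4) and become
the coordinates `y₅…y₉` of a small final vector `(t, π², ν, a, ê₁, B̂, P̂, Â, Q̂₁, Ĵ₁)` (`finalBox`).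
(3) ASSEMBLY at order `t` (the common factor `t` of numerator and denominator cancelled):
`N₁′ = −6ê₁B̂ + 9Q̂₁B̂/P̂ − ½ê₁t(3νP̂ − (3/2)Q̂₁ + 12a(a+π²ν)Â) − 3Ĵ₁`, `U′ = 192π⁶(3ν − (3/2)Q̂₁/P̂)`, `c₁″ = N₁′/U′`
(`KT1Assembly.n1_ge_pieces`, `KT1Assembly.Tplus_bracket`: `N₁ ≥ tN₁′·(4π²t²)⁻¹…`, see `…N1RowExprSound`).
(4) ★ `n1CellCheck c a₁ a₂ M₂ cmin (prec, iters) : Bool` — stages (1)(2) succeed, `P̂ ≥ 1`, `U′ ≥ 1`, and `cmin·U′ − N₁′ ≤ 0` on the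
final box; one `decide +kernel` per cell.  No soundness here (`…N1RowExprSound`: `n1CellCheck = true ∧ c.check = true ⟹
∀ L ≥ 128, ground profile with (ν, a) in the cell: c₁″ ≥ cmin`, hypotheses = PartN41-B §2/§5/§6).
Prover seat `hubbard-h0-rotor-p2` g4; helper for piece A = stmt-HubbardSuperconductivity-23918 of rung 19089
(`--supports`, helper class).  Nothing here proves superconductivity in the Hubbard model; computable helper definitions of ONE
conditional reduction (the GM₃ ∀L certificate, Level-2 row `N₁`); the rotor TARGET as originally worded stays FALSE (g15 verdict).
Mathlib + the tree only; no sorry.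
-/

set_option linter.dupNamespace false
set_option autoImplicit false

open Literature.Analysis.ValidatedNumerics

namespace Summit.HubbardSuperconductivity.HubbardSuperconductivity.Theorems.AnisotropyChord.Transfer.Fibre3.L2.N1

/-! ## (1) The staged box -/

/-- `ê₁ = ε₁/t ∈ [½ − t/24, ½]`. -/
def e1Spec : RExpr × RExpr := (.sub (cst (1/2)) (.mul vT (cst (1/24))), cst (1/2))
/-- the shifted energy `ε*(E) := 2ν + (E − 2ν)/(1 + k(E − 2ν))`, `k = aε/(3νu)`: the unique solution of
`ρ(ε*) = ρ(E) + aε/(2u)` (`ρ(e) = 1 + 3ν/(2e − 4ν)`), so that `κ = 4c_suρ(ε*) = 4c_suρ(E) + 2ac_s/V` is the REPAIRED tail slope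
`κ̂′` of `OuterMaj.tail_slope_abs` (p1 g26 FINDING 04:25Z); increasing in `E` (`y ↦ y/(1+ky)`). -/
def epsStar (E : RExpr) : RExpr :=
  let y := .sub E (.mul (cst 2) vNu)
  let k := .mul (.mul vA eps) (.inv (.mul (.mul (cst 3) vNu) uu))
  .add (.mul (cst 2) vNu) (.mul y (.inv (.add (cst 1) (.mul k y))))
/-- the auxiliary energy coordinate `x₁₇ = ε*(ε̂_M)`, `ε̂_M = (1 − cos Mθ)/t ∈ [M²/2 − M⁴t/24, M²/2]`, boxed by monotonicity in
`[ε*(M²/2 − M⁴t/24), ε*(M²/2)]` (so `rho`, `kap` of part 1 evaluate to `ρ(ε̂_M) + aε/(2u)` and `κ̂′`).  (A wide box is NOT usable: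
`rho` mentions `x₁₇` twice and interval dependency would blow `κ` up — measured: `[M²/4, M²/2]` quadruples it.) -/
def emSpec (M : ℕ) : RExpr × RExpr :=
  (epsStar (.sub (cst ((M : ℚ) ^ 2 / 2)) (.mul vT (cst ((M : ℚ) ^ 4 / 24)))), epsStar (cst ((M : ℚ) ^ 2 / 2)))
/-- `cos(θ/2) ∈ [1 − t/8, 1]`. -/
def cosHalfSpec : RExpr × RExpr := (.sub (cst 1) (.mul vT (cst (1/8))), cst 1)
/-- lower tail endpoint `t̂(q) ≥ −2ac_sĝ(q)ε` (`TtailBounds`). -/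
def ttLoE (M : ℕ) (q : ℤ × ℤ) : RExpr := .neg (.mul (.mul (.mul (.mul (cst 2) vA) cs) (vG M q)) eps)
/-- `tκ_q = 2c_su/(Ê(q)/2 − 2ν)` (`TtailBounds` upper). -/
def kapq (M : ℕ) (q : ℤ × ℤ) : RExpr :=
  .mul (.mul (.mul (cst 2) cs) uu) (.inv (.sub (.mul (Eh M q) (cst (1/2))) (.mul (cst 2) vNu)))
/-- upper tail endpoint `t̂(q) ≤ min(σ̂, tκ_q)`. -/
def ttHiE (M : ℕ) (q : ℤ × ℤ) : RExpr := .min sig (kapq M q)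
/-- `cos(mθ) ∈ [1 − m²t/2, 1 − m²t/2 + m⁴t²/24]`. -/
def cosSpec (m : ℕ) : RExpr × RExpr :=
  (.sub (cst 1) (.mul vT (cst ((m : ℚ) ^ 2 / 2))),
   .add (.sub (cst 1) (.mul vT (cst ((m : ℚ) ^ 2 / 2)))) (.mul (.sq vT) (cst ((m : ℚ) ^ 4 / 24))))
/-- `w_n = (1 − cos nθ)/t ∈ [n²/2 − n⁴t/24, n²/2]`. -/
def wSpec (n : ℕ) : RExpr × RExpr :=
  (.sub (cst ((n : ℚ) ^ 2 / 2)) (.mul vT (cst ((n : ℚ) ^ 4 / 24))), cst ((n : ℚ) ^ 2 / 2))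
/-- the ordered endpoint specs of the coordinates `16, 17, 18, ĝ-block, t̂-block, cos-block, w-block`. -/
def specs (M2 : ℕ) : List (RExpr × RExpr) :=
  let M := M2 + 1
  [e1Spec, emSpec M, cosHalfSpec] ++ ((gridPts M).map fun q => (L2.ghatLoE q, L2.ghatHiE q)) ++
    ((gridPts M).map fun q => (ttLoE M q, ttHiE M q)) ++ ((List.range M).map fun i => cosSpec (i + 1)) ++
    ((List.range M).map fun i => wSpec (i + 1))

/-- the generic staged extension: append, for each spec in order, the coordinate box
`[encl(lo on the box so far).fst, encl(hi on the box so far).snd]`; `none` if an enclosure fails. -/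
def extendBox (prec iters : ℕ) : Box → List (RExpr × RExpr) → Option Box
  | B, [] => some B
  | B, s :: rest =>
    match s.1.enclose prec iters B.toIvl, s.2.enclose prec iters B.toIvl with
    | some I, some J => extendBox prec iters (B ++ [(I.fst, J.snd)]) rest
    | _, _ => none

/-! ## (2) The object stage -/

/-- the five object brackets `(B̂, P̂, Â, Q̂₁, Ĵ₁)` of parts 1–4. -/
def objSpecs (M2 : ℕ) : List (RExpr × RExpr) :=
  [(B2lo M2, B2hi M2), (P2lo M2, P2hi M2), (A2lo M2, A2hi M2), (Q1lo M2, Q1hi M2), (J1lo M2, J1hi M2)]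
/-- enclose each object bracket on the full box: the list of `(encl(lo).fst, encl(hi).snd)`. -/
def encloseObjs (prec iters : ℕ) (B : Box) : List (RExpr × RExpr) → Option (List (ℚ × ℚ))
  | [] => some []
  | s :: rest =>
    match s.1.enclose prec iters B.toIvl, s.2.enclose prec iters B.toIvl, encloseObjs prec iters B rest with
    | some I, some J, some l => some ((I.fst, J.snd) :: l)
    | _, _, _ => none
/-- the final ten-variable box `(t, π², ν, a, ê₁, B̂, P̂, Â, Q̂₁, Ĵ₁)`. -/
def finalBox (B : Box) (objs : List (ℚ × ℚ)) : Box :=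
  [B.getD 0 (0, 0), B.getD 1 (0, 0), B.getD 2 (0, 0), B.getD 3 (0, 0), B.getD 16 (0, 0)] ++ objs

/-! ## (3) The assembly at order `t` (final-stage variables) -/

/-- `t`. -/
def fT : RExpr := .var 0
/-- `π²`. -/
def fPi2 : RExpr := .var 1
/-- `ν`. -/
def fNu : RExpr := .var 2
/-- `a`. -/
def fA : RExpr := .var 3
/-- `ê₁`. -/
def fE1 : RExpr := .var 4
/-- `B̂`. -/
def fB : RExpr := .var 5
/-- `P̂`. -/
def fP : RExpr := .var 6
/-- `Â`. -/
def fAx : RExpr := .var 7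
/-- `Q̂₁`. -/
def fQ : RExpr := .var 8
/-- `Ĵ₁`. -/
def fJ : RExpr := .var 9
/-- ★ `N₁′ = −6ê₁B̂ + 9Q̂₁B̂/P̂ − ½ê₁t(3νP̂ − (3/2)Q̂₁ + 12a(a+π²ν)Â) − 3Ĵ₁` (`4π²t·N₁ ≥ t·N₁′`). -/
def N1pE : RExpr :=
  rsum [ .neg (.mul (.mul (cst 6) fE1) fB), .mul (.mul (.mul (cst 9) fQ) fB) (.inv fP),
    .neg (.mul (.mul (.mul (cst (1/2)) fE1) fT) (rsum [ .mul (.mul (cst 3) fNu) fP, .neg (.mul (cst (3/2)) fQ),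
      .mul (.mul (cst 12) (.mul fA (.add fA (.mul fPi2 fNu)))) fAx ])),
    .neg (.mul (cst 3) fJ) ]
/-- ★ `U′ = 192π⁶(3ν − (3/2)Q̂₁/P̂)` (`4π²t·U ≤ t·U′`, `U = 3V²T₊`). -/
def UpE : RExpr := .mul (.mul (cst 192) (cube fPi2)) (.sub (.mul (cst 3) fNu) (.mul (.mul (cst (3/2)) fQ) (.inv fP)))
/-- the margin `cmin·U′ − N₁′` (claim: `≤ 0`). -/
def marginE (cmin : ℚ) : RExpr := .sub (.mul (cst cmin) UpE) N1pE

/-! ## (4) The cell checker -/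

/-- the full staged box of a cell (stage 1), if all enclosures succeed. -/
def cellBox (c : L2.NamedCell) (a1 a2 : ℚ) (M2 : ℕ) (pi : ℕ × ℕ) : Option Box :=
  extendBox pi.1 pi.2 (c.box a1 a2) (specs M2)
/-- the final box of a cell (stages 1–2), if all enclosures succeed. -/
def cellFinalBox (c : L2.NamedCell) (a1 a2 : ℚ) (M2 : ℕ) (pi : ℕ × ℕ) : Option Box :=
  match cellBox c a1 a2 M2 pi with
  | none => none
  | some B =>
    match encloseObjs pi.1 pi.2 B (objSpecs M2) with
    | none => none
    | some objs => some (finalBox B objs)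
/-- ★ THE CELL CHECK of row `N₁`: on the `(ν, a)`-cell of `c, a₁, a₂` (all `L ≥ 128` at once), `P̂ ≥ 1`, `U′ ≥ 1` and
`c₁″ = N₁′/U′ ≥ cmin`. -/
def n1CellCheck (c : L2.NamedCell) (a1 a2 : ℚ) (M2 : ℕ) (cmin : ℚ) (pi : ℕ × ℕ) : Bool :=
  match cellFinalBox c a1 a2 M2 pi with
  | none => false
  | some F => rexprLeOn (.neg fP) (-1) F pi && rexprLeOn (.neg UpE) (-1) F pi && rexprLeOn (marginE cmin) 0 F pi

end Summit.HubbardSuperconductivity.HubbardSuperconductivity.Theorems.AnisotropyChord.Transfer.Fibre3.L2.N1
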